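import Literature.MathematicalPhysics.QuantumFieldTheory.Balaban1983to89.B14Eq22Determines
import Literature.MathematicalPhysics.QuantumFieldTheory.Balaban1983to89.B10Eq27TorusAxialLog
import HarnessLib

/-!
# S2β · (CURL-AVG, LETTER M-1″) σ FROM SUP PROFILES: the SOURCE hypothesis of px16 g23's composed dilution kernel (K5) — `src i (blockIter i x) ≤ σ i` on the `|rel| ≤ 2` region under
# the coarse site `y` — DISCHARGED for ✓p831575's explicit source polynomial from per-level sup profiles of its four arguments (loop size `α`, plaquette size `δ`, coarse plaquette size `α^p`,
# local fluctuation size `M`), by monotonicity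

Cell `ym3-torus` (YM ladder rung R3 = continuum `SU(2)` Yang–Mills on the three-torus at fixed lattice data — a RUNG: NOT d = 4, NOT infinite volume, NOT a mass gap,
NOT Clay).  Width seat `ym3-torus-px13` (gen 27); crux `stmt-QuantumFields-20520`, LINE g18-1 S2β, pairing lane; (SCT′-c)₁ road of record: CURL-AVG (✓A–F) → rows in (K5) shape
(✓p831575 `…CoarseCurlRowsLL.rows_LL_tower_SU2_K5`, source `src i z = L·L·2δ_i(3L+2)·M i z + 48α_i·L·M i z + (2α^p_i + 24α_i)·ℓ·M i z + 4·404·ℓ·α_i·M i z + 4·4550400·ℓ²·(M i z)² + 2δ_i·L²·M i z`)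
→ px16 g23's `exists_composedKernel` (K5): conclusion `ρ_r(y) ≤ Σ_z K y z·ρ_0 z + Σ_{i=1}^{r} (L²)^{r−i}·σ_i` under the SOURCE hypothesis
`∀ i, 1 ≤ i → i ≤ r → ∀ x : Site P 0, (∀ κ, (rel y (blockIter r x) κ).natAbs ≤ 2) → src i (blockIter i x) ≤ σ i`.  THIS FILE supplies that hypothesis from sup profiles.
`--kind proof --supports stmt-QuantumFields-20520 --as helper`, count-neutral, DEFINITION-FREE; generic `P : Params`.

WHAT IS PROVED (sorry-free).  ★`src_mono` — the source polynomial is monotone in `(α, δ, α^p, M) ≥ 0` (`L, ℓ ≥ 0`); ★★`source_of_profiles` — the SOURCE hypothesis VERBATIM for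
`src := fun i z => …` and `σ := fun i => (the same polynomial at ᾱ i, δ̄ i, ᾱ^p i, M̄ i)`, from `0 ≤ α i ≤ ᾱ i`, `0 ≤ δ i ≤ δ̄ i`, `0 ≤ α^p i ≤ ᾱ^p i` (`1 ≤ i ≤ r`) and
`0 ≤ M i (blockIter i x) ≤ M̄ i` on the region `{x : ∀ κ, |rel y (blockIter r x)|_κ ≤ 2}`; ★★`source_of_local_profiles` — the `Y`-DEPENDENT edition = the torus
knit's `hτ` (`τ n Y j`, local size profile `M̄ n Y j` per read cell).

HONEST.  Real arithmetic; nothing of Bałaban's asserted; the profiles themselves (θ-suppression of `M`, the guards along the descended tower) are the (M,V)-typist's HYPOTHESES; (K0)–(K5), the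
dock, (★), (SCT′-c)₁₂₃, (LIFT-LAD′), (TOP-LAD′), (ST′), (ST), LOC, GAP♯∘ (`stub_uniformFibreGapOrbit`, registry 3732b7df UNTOUCHED, 0∕5), the five REGISTERED stubs, S2β, crux 20520, 19936,
19200, `YM3TorusSU2` — NOT proved; rung R3 = SU(2) YM₃ on T³ — NOT d = 4, NOT infinite volume, NOT a mass gap, NOT Clay; the Yang–Mills mass gap is NOT proved.  Axioms standard.

References: [Balaban1985Averaging] CMP **98** (1985) Prop. 3 (121)–(126) p.36, Prop. 4 (128)–(135) pp.37–38; [Balaban1987RG1] CMP **109** (1987) (0.4), (0.8), (0.18) pp.253–255.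
-/

set_option autoImplicit false

namespace Summit.QuantumFields.YangMills.Theorems.FluctuationComparisonRegPrIntLS2BetaCoarseCurlSourceProfile

open Literature.MathematicalPhysics.QuantumFieldTheory.Balaban1983to89
open Literature.MathematicalPhysics.QuantumFieldTheory.Balaban1983to89.B14.Eq22Determines (blockIter)
open Literature.MathematicalPhysics.QuantumFieldTheory.Balaban1983to89.B10Eq27TorusAxialLog (rel)

/-- ★ **THE SOURCE POLYNOMIAL IS MONOTONE** in its four nonnegative arguments `(α, δ, α^p, M)` (coefficients `L, ℓ ≥ 0`). [folklore] -/
theorem src_mono {L ℓ α α' δ δ' αp αp' M M' : ℝ} (hL : 0 ≤ L) (hℓ : 0 ≤ ℓ) (hα : 0 ≤ α) (hαα : α ≤ α') (hδ : 0 ≤ δ) (hδδ : δ ≤ δ') (hαp : 0 ≤ αp) (hpp : αp ≤ αp')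
    (hM : 0 ≤ M) (hMM : M ≤ M') :
    L * (L * (2 * δ * (L + 2 * L + 2) * M)) + 48 * α * (L * M) + (2 * αp * (ℓ * M) + 24 * α * (ℓ * M)) + 4 * (404 * ℓ * α * M) + 4 * (4550400 * ℓ ^ 2 * M ^ 2) +
        2 * δ * (L ^ 2 * M) ≤
      L * (L * (2 * δ' * (L + 2 * L + 2) * M')) + 48 * α' * (L * M') + (2 * αp' * (ℓ * M') + 24 * α' * (ℓ * M')) + 4 * (404 * ℓ * α' * M') + 4 * (4550400 * ℓ ^ 2 * M' ^ 2) +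
        2 * δ' * (L ^ 2 * M') := by
  have hα' : 0 ≤ α' := hα.trans hαα
  have hδ' : 0 ≤ δ' := hδ.trans hδδ
  have hαp' : 0 ≤ αp' := hαp.trans hpp
  have hM' : 0 ≤ M' := hM.trans hMM
  have hL3 : 0 ≤ L + 2 * L + 2 := by linarith
  have t1 : L * (L * (2 * δ * (L + 2 * L + 2) * M)) ≤ L * (L * (2 * δ' * (L + 2 * L + 2) * M')) := by gcongr
  have t2 : 48 * α * (L * M) ≤ 48 * α' * (L * M') := by gcongr
  have t3 : 2 * αp * (ℓ * M) ≤ 2 * αp' * (ℓ * M') := by gcongr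
  have t4 : 24 * α * (ℓ * M) ≤ 24 * α' * (ℓ * M') := by gcongr
  have t5 : 4 * (404 * ℓ * α * M) ≤ 4 * (404 * ℓ * α' * M') := by gcongr
  have t6 : 4 * (4550400 * ℓ ^ 2 * M ^ 2) ≤ 4 * (4550400 * ℓ ^ 2 * M' ^ 2) := by gcongr
  have t7 : 2 * δ * (L ^ 2 * M) ≤ 2 * δ' * (L ^ 2 * M') := by gcongr
  linarith

variable {P : Params}

/-- ★★ **σ FROM SUP PROFILES** — the SOURCE hypothesis of px16 g23's (K5) VERBATIM for ✓p831575's source `src` and `σ i :=` the source polynomial at the sup profiles, from `0 ≤ α i ≤ ᾱ i`,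
`0 ≤ δ i ≤ δ̄ i`, `0 ≤ α^p i ≤ ᾱ^p i` (`1 ≤ i ≤ r`) and `0 ≤ M i (blockIter i x) ≤ M̄ i` on the `|rel| ≤ 2` region under `y`.
[cite: Balaban1985Averaging, Prop. 4 (128)-(135) pp.37-38; Balaban1987RG1, (0.18) p.255] -/
theorem source_of_profiles (r : ℕ) (y : Site P r) (α δ αp αbar δbar αpbar Mbar : ℕ → ℝ) (M : (i : ℕ) → Site P i → ℝ)
    (hα : ∀ i, 1 ≤ i → i ≤ r → 0 ≤ α i ∧ α i ≤ αbar i) (hδ : ∀ i, 1 ≤ i → i ≤ r → 0 ≤ δ i ∧ δ i ≤ δbar i)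
    (hαp : ∀ i, 1 ≤ i → i ≤ r → 0 ≤ αp i ∧ αp i ≤ αpbar i)
    (hM : ∀ i, 1 ≤ i → i ≤ r → ∀ x : Site P 0, (∀ κ, (rel y (blockIter r x) κ).natAbs ≤ 2) → 0 ≤ M i (blockIter i x) ∧ M i (blockIter i x) ≤ Mbar i)
    (src : (i : ℕ) → Site P i → ℝ) (σ : ℕ → ℝ)
    (hsrc : src = fun i z => (P.L : ℝ) * ((P.L : ℝ) * (2 * δ i * ((P.L : ℝ) + 2 * P.L + 2) * M i z)) + 48 * α i * ((P.L : ℝ) * M i z) +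
            (2 * αp i * ((((P.d + 2) * P.L : ℕ) : ℝ) * M i z) + 24 * α i * ((((P.d + 2) * P.L : ℕ) : ℝ) * M i z)) +
            4 * (404 * (((P.d + 2) * P.L : ℕ) : ℝ) * α i * M i z) + 4 * (4550400 * (((P.d + 2) * P.L : ℕ) : ℝ) ^ 2 * M i z ^ 2) +
            2 * δ i * ((P.L : ℝ) ^ 2 * M i z))
    (hσ : σ = fun i => (P.L : ℝ) * ((P.L : ℝ) * (2 * δbar i * ((P.L : ℝ) + 2 * P.L + 2) * Mbar i)) + 48 * αbar i * ((P.L : ℝ) * Mbar i) +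
            (2 * αpbar i * ((((P.d + 2) * P.L : ℕ) : ℝ) * Mbar i) + 24 * αbar i * ((((P.d + 2) * P.L : ℕ) : ℝ) * Mbar i)) +
            4 * (404 * (((P.d + 2) * P.L : ℕ) : ℝ) * αbar i * Mbar i) + 4 * (4550400 * (((P.d + 2) * P.L : ℕ) : ℝ) ^ 2 * Mbar i ^ 2) +
            2 * δbar i * ((P.L : ℝ) ^ 2 * Mbar i)) :
    ∀ i, 1 ≤ i → i ≤ r → ∀ x : Site P 0, (∀ κ, (rel y (blockIter r x) κ).natAbs ≤ 2) → src i (blockIter i x) ≤ σ i := by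
  subst hsrc hσ
  intro i hi1 hir x hx
  obtain ⟨hM0, hMM⟩ := hM i hi1 hir x hx
  exact src_mono (Nat.cast_nonneg _) (Nat.cast_nonneg _) (hα i hi1 hir).1 (hα i hi1 hir).2 (hδ i hi1 hir).1 (hδ i hi1 hir).2 (hαp i hi1 hir).1 (hαp i hi1 hir).2 hM0 hMM


/-- ★★ **τ FROM LOCAL SUP PROFILES** — the `Y`-DEPENDENT source hypothesis `hτ` of px16 g23's torus knit `…CurlKernelKnitTorus.weighted_readMax_sq_le` VERBATIM
(`∀ n ≤ m, ∀ Y j, 1 ≤ j → j ≤ n → ∀ x, (∀ κ, |rel Y (blockIter n x)|_κ ≤ 2) → src j (blockIter j x) ≤ τ n Y j`) for ✓p831575's `src` and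
`τ n Y j :=` the source polynomial at `(ᾱ j, δ̄ j, ᾱ^p j, M̄ n Y j)`, from per-level guard profiles and a LOCAL size profile `0 ≤ M j (blockIter j x) ≤ M̄ n Y j` on the `|rel| ≤ 2` region under
the read cell `Y` (the θ-suppression is read cell by cell). [cite: Balaban1985Averaging, Prop. 4 (128)-(135) pp.37-38; Balaban1987RG1, (0.18) p.255] -/
theorem source_of_local_profiles (m : ℕ) (α δ αp αbar δbar αpbar : ℕ → ℝ) (M : (i : ℕ) → Site P i → ℝ) (Mbar : (n : ℕ) → Site P n → ℕ → ℝ)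
    (hα : ∀ j, 1 ≤ j → j ≤ m → 0 ≤ α j ∧ α j ≤ αbar j) (hδ : ∀ j, 1 ≤ j → j ≤ m → 0 ≤ δ j ∧ δ j ≤ δbar j)
    (hαp : ∀ j, 1 ≤ j → j ≤ m → 0 ≤ αp j ∧ αp j ≤ αpbar j)
    (hM : ∀ n, n ≤ m → ∀ (Y : Site P n) (j : ℕ), 1 ≤ j → j ≤ n → ∀ x : Site P 0, (∀ κ, (rel Y (blockIter n x) κ).natAbs ≤ 2) →
      0 ≤ M j (blockIter j x) ∧ M j (blockIter j x) ≤ Mbar n Y j)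
    (src : (i : ℕ) → Site P i → ℝ) (τ : (n : ℕ) → Site P n → ℕ → ℝ)
    (hsrc : src = fun i z => (P.L : ℝ) * ((P.L : ℝ) * (2 * δ i * ((P.L : ℝ) + 2 * P.L + 2) * M i z)) + 48 * α i * ((P.L : ℝ) * M i z) +
            (2 * αp i * ((((P.d + 2) * P.L : ℕ) : ℝ) * M i z) + 24 * α i * ((((P.d + 2) * P.L : ℕ) : ℝ) * M i z)) +
            4 * (404 * (((P.d + 2) * P.L : ℕ) : ℝ) * α i * M i z) + 4 * (4550400 * (((P.d + 2) * P.L : ℕ) : ℝ) ^ 2 * M i z ^ 2) +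
            2 * δ i * ((P.L : ℝ) ^ 2 * M i z))
    (hτ : τ = fun n Y j => (P.L : ℝ) * ((P.L : ℝ) * (2 * δbar j * ((P.L : ℝ) + 2 * P.L + 2) * Mbar n Y j)) + 48 * αbar j * ((P.L : ℝ) * Mbar n Y j) +
            (2 * αpbar j * ((((P.d + 2) * P.L : ℕ) : ℝ) * Mbar n Y j) + 24 * αbar j * ((((P.d + 2) * P.L : ℕ) : ℝ) * Mbar n Y j)) +
            4 * (404 * (((P.d + 2) * P.L : ℕ) : ℝ) * αbar j * Mbar n Y j) + 4 * (4550400 * (((P.d + 2) * P.L : ℕ) : ℝ) ^ 2 * Mbar n Y j ^ 2) +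
            2 * δbar j * ((P.L : ℝ) ^ 2 * Mbar n Y j)) :
    ∀ n, n ≤ m → ∀ (Y : Site P n) (j : ℕ), 1 ≤ j → j ≤ n → ∀ x : Site P 0, (∀ κ, (rel Y (blockIter n x) κ).natAbs ≤ 2) →
      src j (blockIter j x) ≤ τ n Y j := by
  subst hsrc hτ
  intro n hn Y j hj1 hjn x hx
  obtain ⟨hM0, hMM⟩ := hM n hn Y j hj1 hjn x hx
  have hjm : j ≤ m := hjn.trans hn
  exact src_mono (Nat.cast_nonneg _) (Nat.cast_nonneg _) (hα j hj1 hjm).1 (hα j hj1 hjm).2 (hδ j hj1 hjm).1 (hδ j hj1 hjm).2 (hαp j hj1 hjm).1 (hαp j hj1 hjm).2 hM0 hMM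

end Summit.QuantumFields.YangMills.Theorems.FluctuationComparisonRegPrIntLS2BetaCoarseCurlSourceProfile
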